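import Summits.QuantumAdvantage.AdviceFreeQNC0.LogDegreeResidueBalance
import HarnessLib

/-!
# Cell qa-qnc0 (rung F-Q1, route RingFrame, crux α, line `product`): three-fold sumsets of dense
# subsets of a Hamming-weight class mod 3 cover the cube

Planner qa-qnc0-p1's `D = 1` unit test of the level-set method (HOME/qa-qnc0-p1/Sketch8b.lean
`LevelSetD1`, TARGET §20.7, ask P6c; locator ask L9) rests on: if `A ⊆ cls_r := {u : |u| ≡ r (mod 3)}`
misses at most `2^L/10` points of the class, then every `x ∈ {0,1}^L` is `a ⊕ b ⊕ c` with `a, b, c ∈ A`.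
Proved here (`three_xor_cover_of_dense_weightClass`, all `L ≥ 30`) by DOUBLE COUNTING with exact class
sizes, not by Fourier bias: the printed sup-bias route (Tao–Vu, *Additive Combinatorics* (2006) §4.3,
Lemma 4.13 "uniformity implies large sum sets", cited for comparison only) reaches density defects
`< (5 − √21)/6 ≈ 0.069` only; the count reaches every defect `< 1/9` (`1/6` is a counterexample,
`A = cls_r ∩ {u₀ = 1}`).  qn-lit LIT-MEMO-12 §11.
* `abs_nine_mul_classPairCount_sub_two_pow_le`: `R(y) := #{b ∈ cls_r : y ⊕ b ∈ cls_r}` has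
  `|9·R(y) − 2^L| ≤ 2·2^{|y|} + 2·2^{L−|y|} + 4` (error terms kept as `Π_i (2 if yᵢ else 1)`,
  `Π_i (1 if yᵢ else 2)`): the tree's `abs_three_mul_card_filter_mod_sub_card_le` on the translate
  `y ⊕ cls_r`, whose character sum is `⅓(S₀ + ω^{2r}S₁ + ω^{4r}S₂)` with twisted sums
  `S_j(y) = Σ_c ω^{j|c|}ω^{|y ⊕ c|} = Π_i (…)` of norms `1, 2^{|y|}, 2^{L−|y|}`.
* `classPairCount_cover`: if `x ∉ A ⊕ A ⊕ A` then `Σ_{a ∈ cls_r} R(x ⊕ a) ≤ 3·Σ_{b ∈ cls_r ∖ A} R(x ⊕ b)`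
  (every triple `(a, b, x ⊕ a ⊕ b)` of class-`r` points meets `cls_r ∖ A`; the three incidence counts
  coincide after the translation `b ↦ x ⊕ a ⊕ b`).
* `three_xor_cover_of_dense_weightClass`: with `Σ_y 2^{|y|} = Σ_y 2^{L−|y|} = 3^L` this gives
  `#cls_r·(2^L − 4) − 4·3^L ≤ 3·#B·(2^L + 4) + 12·3^L`, impossible for `10·#B ≤ 2^L`, `L ≥ 30`.
The class is `univ.filter (fun u ↦ wt u % 3 = r % 3)` with `wt = Hegedus.wt` (as in
`LogDegreeResidueBalance`; it agrees with `AdviceFreeQNC0.wt`, hence with the body of `cls L r` of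
`LDMATransfer.lean`, by `rfl`).  WHAT THIS IS NOT: nothing on `FSB`/`FW`/`LDRAgg` or on α; it is the
combinatorial half of P6c only (affinity of degree-1 columns is not touched).  [folklore throughout]
-/
noncomputable section

namespace Summit.QuantumAdvantage.AdviceFreeQNC0

open Finset
open Literature.Computability.MetaComplexity.Hegedus

variable {L : ℕ}

/-- `a ⊕ (a ⊕ b) = b`. -/
private theorem bool_xor_xor_cancel (a b : Bool) : xor a (xor a b) = b := by
  cases a <;> cases b <;> decide

/-- `(p ⊕ a) ⊕ b = (p ⊕ b) ⊕ a`. -/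
private theorem bool_xor3_comm (p a b : Bool) : xor (xor p a) b = xor (xor p b) a := by
  cases p <;> cases a <;> cases b <;> decide

/-- `p = a ⊕ b ⊕ (p ⊕ a ⊕ b)`. -/
private theorem bool_xor3_rep (p a b : Bool) : p = xor a (xor b (xor (xor p a) b)) := by
  cases p <;> cases a <;> cases b <;> decide

/-- `y ⊕ (y ⊕ c) = c`. [folklore] -/
theorem xorLeft_xorLeft_eq (y c : Fin L → Bool) :
    (fun i => xor (y i) (xor (y i) (c i))) = c :=
  funext fun i => bool_xor_xor_cancel (y i) (c i)

/-- Re-indexing a sum over the cube by the involution `c ↦ y ⊕ c`. [folklore] -/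
theorem sum_comp_xorLeft {M : Type*} [AddCommMonoid M] (y : Fin L → Bool)
    (g : (Fin L → Bool) → M) :
    ∑ c : Fin L → Bool, g (fun i => xor (y i) (c i)) = ∑ b : Fin L → Bool, g b :=
  Equiv.sum_comp (Function.Involutive.toPerm (fun c : Fin L → Bool => fun i => xor (y i) (c i))
    fun c => xorLeft_xorLeft_eq y c) g

/-- `z^{|u|} = Π_i (z if uᵢ else 1)`. [folklore] -/
theorem pow_wt_eq_prod_ite {M : Type*} [CommMonoid M] (z : M) (u : Fin L → Bool) :
    z ^ wt u = ∏ i, (if u i = true then z else 1) := by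
  unfold wt; rw [← Finset.prod_filter, Finset.prod_const]

/-- `Σ_y Π_i (a if yᵢ else b) = (a + b)^L` (so `Σ_y 2^{|y|} = Σ_y 2^{L−|y|} = 3^L`). [folklore] -/
theorem sum_prod_ite_eq_add_pow (L : ℕ) (a b : ℝ) :
    ∑ y : Fin L → Bool, (∏ i, if y i = true then a else b) = (a + b) ^ L := by
  rw [← Fintype.prod_sum fun (_ : Fin L) (c : Bool) => if c = true then a else b]
  simp only [Fintype.sum_bool, if_true, Bool.false_eq_true, if_false]
  rw [Finset.prod_const, Finset.card_univ, Fintype.card_fin]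

/-- `S_j(y) = Π_i (ω + ω^j if yᵢ else 1 + ω^j·ω)`. [folklore] -/
theorem twistedOmega3Sum_eq_prod (j : ℕ) (y : Fin L → Bool) :
    ∑ c : Fin L → Bool, (omega3 ^ j) ^ wt c * omega3 ^ wt (fun i => xor (y i) (c i)) =
      ∏ i, (if y i = true then omega3 + omega3 ^ j else 1 + omega3 ^ j * omega3) := by
  have h : ∀ c : Fin L → Bool,
      (omega3 ^ j) ^ wt c * omega3 ^ wt (fun i => xor (y i) (c i)) =
        ∏ i, ((if c i = true then omega3 ^ j else 1) *
          (if xor (y i) (c i) = true then omega3 else 1)) := by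
    intro c
    rw [pow_wt_eq_prod_ite, pow_wt_eq_prod_ite, ← Finset.prod_mul_distrib]
  simp_rw [h]
  rw [← Fintype.prod_sum fun (i : Fin L) (b : Bool) =>
    (if b = true then omega3 ^ j else 1) * (if xor (y i) b = true then omega3 else 1)]
  refine Finset.prod_congr rfl fun i _ => ?_
  rw [Fintype.sum_bool]
  cases y i <;> simp <;> ring

/-- `‖2ω‖ = 2`. -/
private theorem norm_omega3_add_omega3 : ‖omega3 + omega3‖ = 2 := by
  rw [← two_mul, norm_mul, norm_omega3, mul_one]; simp

/-- `‖1 + ω²‖ = 1`. -/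
private theorem norm_one_add_omega3_mul_omega3 : ‖1 + omega3 * omega3‖ = 1 := by
  have h : (1 : ℂ) + omega3 * omega3 = -omega3 := by linear_combination one_add_omega3_add_sq
  rw [h, norm_neg, norm_omega3]

/-- `‖ω + ω²‖ = 1`. -/
private theorem norm_omega3_add_omega3_sq : ‖omega3 + omega3 ^ 2‖ = 1 := by
  have h : omega3 + omega3 ^ 2 = -1 := by linear_combination one_add_omega3_add_sq
  rw [h, norm_neg, norm_one]

/-- `‖1 + ω³‖ = 2`. -/
private theorem norm_one_add_omega3_sq_mul_omega3 : ‖1 + omega3 ^ 2 * omega3‖ = 2 := by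
  have h : omega3 ^ 2 * omega3 = 1 := by rw [← pow_succ, omega3_pow_three]
  rw [h]
  norm_num

/-- `‖S₁(y)‖ = Π_i (2 if yᵢ else 1) = 2^{|y|}`. [folklore] -/
theorem norm_twistedOmega3Sum_one (y : Fin L → Bool) :
    ‖∑ c : Fin L → Bool, omega3 ^ wt c * omega3 ^ wt (fun i => xor (y i) (c i))‖ =
      ∏ i, (if y i = true then (2 : ℝ) else 1) := by
  have h := twistedOmega3Sum_eq_prod 1 y
  simp only [pow_one] at h
  rw [h, norm_prod]
  refine Finset.prod_congr rfl fun i _ => ?_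
  split_ifs
  · exact norm_omega3_add_omega3
  · exact norm_one_add_omega3_mul_omega3

/-- `‖S₂(y)‖ = Π_i (1 if yᵢ else 2) = 2^{L−|y|}`. [folklore] -/
theorem norm_twistedOmega3Sum_two (y : Fin L → Bool) :
    ‖∑ c : Fin L → Bool, (omega3 ^ 2) ^ wt c * omega3 ^ wt (fun i => xor (y i) (c i))‖ =
      ∏ i, (if y i = true then (1 : ℝ) else 2) := by
  rw [twistedOmega3Sum_eq_prod 2 y, norm_prod]
  refine Finset.prod_congr rfl fun i _ => ?_
  split_ifs
  · exact norm_omega3_add_omega3_sq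
  · exact norm_one_add_omega3_sq_mul_omega3

/-- `1 + ω^m + ω^{2m} = 3·[3 ∣ m]`. [folklore] -/
theorem one_add_omega3_pow_add_omega3_pow_two_mul (m : ℕ) :
    (1 : ℂ) + omega3 ^ m + omega3 ^ (2 * m) = if m % 3 = 0 then 3 else 0 := by
  rw [omega3_pow_eq_pow_mod m, omega3_pow_eq_pow_mod (2 * m)]
  have hm : m % 3 < 3 := Nat.mod_lt _ (by norm_num)
  have h2 : 2 * m % 3 = (2 * (m % 3)) % 3 := by omega
  rw [h2]
  interval_cases m % 3
  · norm_num
  · rw [if_neg (by norm_num)]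
    norm_num
    linear_combination one_add_omega3_add_sq
  · rw [if_neg (by norm_num)]
    norm_num
    linear_combination one_add_omega3_add_sq

/-- `3·Σ_{c ∈ cls_r} ω^{|y ⊕ c|} = S₀(y) + ω^{2r}·S₁(y) + ω^{4r}·S₂(y)`. [folklore] -/
theorem three_mul_classSum_omega3_pow_wt_xorLeft (r : ℕ) (y : Fin L → Bool) :
    (3 : ℂ) * ∑ c ∈ univ.filter (fun u : Fin L → Bool => wt u % 3 = r % 3),
        omega3 ^ wt (fun i => xor (y i) (c i)) =
      (∑ c : Fin L → Bool, omega3 ^ wt (fun i => xor (y i) (c i))) +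
      omega3 ^ (2 * r) *
        (∑ c : Fin L → Bool, omega3 ^ wt c * omega3 ^ wt (fun i => xor (y i) (c i))) +
      omega3 ^ (4 * r) *
        (∑ c : Fin L → Bool, (omega3 ^ 2) ^ wt c * omega3 ^ wt (fun i => xor (y i) (c i))) := by
  rw [Finset.sum_filter, Finset.mul_sum, Finset.mul_sum, Finset.mul_sum,
    ← Finset.sum_add_distrib, ← Finset.sum_add_distrib]
  refine Finset.sum_congr rfl fun c _ => ?_
  set z := omega3 ^ wt (fun i => xor (y i) (c i)) with hz
  have key := one_add_omega3_pow_add_omega3_pow_two_mul (wt c + 2 * r)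
  have e : z + omega3 ^ (2 * r) * (omega3 ^ wt c * z) + omega3 ^ (4 * r) * ((omega3 ^ 2) ^ wt c * z)
      = ((1 : ℂ) + omega3 ^ (wt c + 2 * r) + omega3 ^ (2 * (wt c + 2 * r))) * z := by ring
  rw [e, key]
  by_cases hc : wt c % 3 = r % 3
  · rw [if_pos hc, if_pos (by omega)]
  · rw [if_neg hc, if_neg (by omega), mul_zero, zero_mul]

/-- `3·‖Σ_{c ∈ cls_r} ω^{|y ⊕ c|}‖ ≤ 1 + 2^{|y|} + 2^{L−|y|}` (error terms as products). [folklore] -/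
theorem three_mul_norm_classSum_le (r : ℕ) (y : Fin L → Bool) :
    3 * ‖∑ c ∈ univ.filter (fun u : Fin L → Bool => wt u % 3 = r % 3),
        omega3 ^ wt (fun i => xor (y i) (c i))‖ ≤
      1 + (∏ i, if y i = true then (2 : ℝ) else 1) + (∏ i, if y i = true then (1 : ℝ) else 2) := by
  have h3 : (3 : ℝ) * ‖∑ c ∈ univ.filter (fun u : Fin L → Bool => wt u % 3 = r % 3),
      omega3 ^ wt (fun i => xor (y i) (c i))‖ =
      ‖(3 : ℂ) * ∑ c ∈ univ.filter (fun u : Fin L → Bool => wt u % 3 = r % 3),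
        omega3 ^ wt (fun i => xor (y i) (c i))‖ := by
    rw [norm_mul]
    simp
  have hS0 : ‖∑ c : Fin L → Bool, omega3 ^ wt (fun i => xor (y i) (c i))‖ = 1 := by
    rw [sum_comp_xorLeft y (fun b => omega3 ^ wt b), norm_sum_omega3_pow_wt]
  rw [h3, three_mul_classSum_omega3_pow_wt_xorLeft]
  refine norm_add₃_le.trans (le_of_eq ?_)
  rw [norm_mul, norm_mul, norm_pow, norm_pow, norm_omega3, one_pow, one_pow, one_mul, one_mul, hS0,
    norm_twistedOmega3Sum_one, norm_twistedOmega3Sum_two]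

/-- `Σ_{u ∈ y ⊕ cls_r} ω^{|u|} = Σ_{c ∈ cls_r} ω^{|y ⊕ c|}`. [folklore] -/
theorem sum_translateClass_omega3_pow_wt (r : ℕ) (y : Fin L → Bool) :
    ∑ u ∈ univ.filter (fun b : Fin L → Bool => wt (fun i => xor (y i) (b i)) % 3 = r % 3),
        omega3 ^ wt u =
      ∑ c ∈ univ.filter (fun u : Fin L → Bool => wt u % 3 = r % 3),
        omega3 ^ wt (fun i => xor (y i) (c i)) := by
  rw [Finset.sum_filter, Finset.sum_filter,
    ← sum_comp_xorLeft y
      (fun u => if wt (fun i => xor (y i) (u i)) % 3 = r % 3 then omega3 ^ wt u else 0)]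
  simp_rw [xorLeft_xorLeft_eq]

/-- `#(y ⊕ cls_r) = #cls_r`. [folklore] -/
theorem card_translateClass (r : ℕ) (y : Fin L → Bool) :
    (univ.filter (fun b : Fin L → Bool => wt (fun i => xor (y i) (b i)) % 3 = r % 3)).card =
      (univ.filter (fun u : Fin L → Bool => wt u % 3 = r % 3)).card := by
  rw [Finset.card_filter, Finset.card_filter,
    ← sum_comp_xorLeft y
      (fun u => if wt (fun i => xor (y i) (u i)) % 3 = r % 3 then 1 else 0)]
  simp_rw [xorLeft_xorLeft_eq]

/-- **Pair counts.** For every `y`, `R(y) := #{b ∈ cls_r : y ⊕ b ∈ cls_r}` satisfies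
`|9·R(y) − 2^L| ≤ 2·2^{|y|} + 2·2^{L−|y|} + 4`. [folklore] -/
theorem abs_nine_mul_classPairCount_sub_two_pow_le (r : ℕ) (y : Fin L → Bool) :
    |9 * ((univ.filter fun b : Fin L → Bool =>
        wt (fun i => xor (y i) (b i)) % 3 = r % 3 ∧ wt b % 3 = r % 3).card : ℝ) - (2 : ℝ) ^ L| ≤
      2 * (∏ i, if y i = true then (2 : ℝ) else 1) +
        2 * (∏ i, if y i = true then (1 : ℝ) else 2) + 4 := by
  have h1 := abs_three_mul_card_filter_mod_sub_card_le
    (univ.filter fun b : Fin L → Bool => wt (fun i => xor (y i) (b i)) % 3 = r % 3) r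
  rw [Finset.filter_filter, sum_translateClass_omega3_pow_wt, card_translateClass] at h1
  have h2 := three_mul_norm_classSum_le r y
  have h3 := abs_three_mul_card_filter_mod_sub_card_le (univ : Finset (Fin L → Bool)) r
  rw [norm_sum_omega3_pow_wt, Finset.card_univ, Fintype.card_fun, Fintype.card_bool,
    Fintype.card_fin] at h3
  push_cast at h3
  rw [abs_le] at h1 h3 ⊢
  constructor <;> linarith [h1.1, h1.2, h3.1, h3.2]

/-- **Covering count.** If `x ∉ A ⊕ A ⊕ A` for `A ⊆ cls_r`, then every triple `(a, b, x ⊕ a ⊕ b)` of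
class-`r` points meets `cls_r ∖ A`, whence `Σ_{a ∈ cls_r} R(x ⊕ a) ≤ 3·Σ_{b ∈ cls_r ∖ A} R(x ⊕ b)`.
[folklore] -/
theorem classPairCount_cover (r : ℕ) (A : Finset (Fin L → Bool))
    (hA : A ⊆ univ.filter fun u : Fin L → Bool => wt u % 3 = r % 3) (x : Fin L → Bool)
    (hno : ¬ ∃ a ∈ A, ∃ b ∈ A, ∃ c ∈ A, ∀ i, x i = xor (a i) (xor (b i) (c i))) :
    ∑ a ∈ univ.filter (fun u : Fin L → Bool => wt u % 3 = r % 3),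
        (univ.filter fun b : Fin L → Bool =>
          wt (fun i => xor (xor (x i) (a i)) (b i)) % 3 = r % 3 ∧ wt b % 3 = r % 3).card ≤
      3 * ∑ a ∈ (univ.filter fun u : Fin L → Bool => wt u % 3 = r % 3) \ A,
        (univ.filter fun b : Fin L → Bool =>
          wt (fun i => xor (xor (x i) (a i)) (b i)) % 3 = r % 3 ∧ wt b % 3 = r % 3).card := by
  set C := univ.filter (fun u : Fin L → Bool => wt u % 3 = r % 3) with hC
  set f : (Fin L → Bool) → ℕ := fun a => (univ.filter fun b : Fin L → Bool =>
      wt (fun i => xor (xor (x i) (a i)) (b i)) % 3 = r % 3 ∧ wt b % 3 = r % 3).card with hf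
  set g : (Fin L → Bool) → ℕ := fun a => (univ.filter fun b : Fin L → Bool =>
      b ∈ C \ A ∧ wt (fun i => xor (xor (x i) (a i)) (b i)) % 3 = r % 3).card with hg
  set g' : (Fin L → Bool) → ℕ := fun a => (univ.filter fun b : Fin L → Bool =>
      (fun i => xor (xor (x i) (a i)) (b i)) ∈ C \ A ∧ wt b % 3 = r % 3).card with hg'
  have hK : ∀ a ∈ A, f a ≤ g a + g' a := by
    intro a ha
    simp only [hf, hg, hg']
    refine (Finset.card_le_card ?_).trans (Finset.card_union_le _ _)
    intro b hb
    rw [Finset.mem_filter] at hb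
    obtain ⟨-, hbt, hbr⟩ := hb
    rw [Finset.mem_union, Finset.mem_filter, Finset.mem_filter]
    by_cases hbA : b ∈ A
    · by_cases hcA : (fun i => xor (xor (x i) (a i)) (b i)) ∈ A
      · exact (hno ⟨a, ha, b, hbA, _, hcA, fun i => bool_xor3_rep (x i) (a i) (b i)⟩).elim
      · right
        exact ⟨Finset.mem_univ _, Finset.mem_sdiff.2
          ⟨by rw [hC, Finset.mem_filter]; exact ⟨Finset.mem_univ _, hbt⟩, hcA⟩, hbr⟩
    · left
      exact ⟨Finset.mem_univ _, Finset.mem_sdiff.2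
        ⟨by rw [hC, Finset.mem_filter]; exact ⟨Finset.mem_univ _, hbr⟩, hbA⟩, hbt⟩
  have hgg : ∀ a, g' a = g a := by
    intro a
    simp only [hg, hg']
    rw [Finset.card_filter, Finset.card_filter,
      ← sum_comp_xorLeft (fun i => xor (x i) (a i)) (fun b =>
        if (fun i => xor (xor (x i) (a i)) (b i)) ∈ C \ A ∧ wt b % 3 = r % 3 then 1 else 0)]
    refine Finset.sum_congr rfl fun c _ => ?_
    have e : (fun i => xor (xor (x i) (a i)) (xor (xor (x i) (a i)) (c i))) = c :=
      funext fun i => bool_xor_xor_cancel _ _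
    simp only [e]
  have hS : ∑ a ∈ C, g a = ∑ b ∈ C \ A, f b := by
    have lhs : ∀ a, g a =
        ∑ b ∈ C \ A, if wt (fun i => xor (xor (x i) (a i)) (b i)) % 3 = r % 3 then 1 else 0 := by
      intro a
      simp only [hg]
      rw [Finset.card_filter]; simp_rw [ite_and]
      rw [← Finset.sum_filter, Finset.filter_mem_eq_inter, Finset.univ_inter]
    have rhs : ∀ b, f b =
        ∑ a ∈ C, if wt (fun i => xor (xor (x i) (a i)) (b i)) % 3 = r % 3 then 1 else 0 := by
      intro b
      simp only [hf]
      rw [Finset.card_filter, hC, Finset.sum_filter]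
      refine Finset.sum_congr rfl fun a _ => ?_
      have e : (fun i => xor (xor (x i) (b i)) (a i)) = (fun i => xor (xor (x i) (a i)) (b i)) :=
        funext fun i => bool_xor3_comm _ _ _
      rw [e]
      by_cases h2 : wt a % 3 = r % 3
      · by_cases h1 : wt (fun i => xor (xor (x i) (a i)) (b i)) % 3 = r % 3
        · rw [if_pos ⟨h1, h2⟩, if_pos h2, if_pos h1]
        · rw [if_neg (fun h => h1 h.1), if_pos h2, if_neg h1]
      · rw [if_neg (fun h => h2 h.2), if_neg h2]
    simp_rw [lhs, rhs]
    exact Finset.sum_comm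
  have hsplit : ∑ a ∈ C \ A, f a + ∑ a ∈ A, f a = ∑ a ∈ C, f a := Finset.sum_sdiff hA
  have hAA : ∑ a ∈ A, f a ≤ 2 * ∑ b ∈ C \ A, f b :=
    calc ∑ a ∈ A, f a ≤ ∑ a ∈ A, (g a + g' a) := Finset.sum_le_sum hK
      _ = 2 * ∑ a ∈ A, g a := by
          rw [Finset.sum_add_distrib, Finset.sum_congr rfl fun a _ => hgg a, two_mul]
      _ ≤ 2 * ∑ a ∈ C, g a := Nat.mul_le_mul_left _ (Finset.sum_le_sum_of_subset hA)
      _ = 2 * ∑ b ∈ C \ A, f b := by rw [hS]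
  calc ∑ a ∈ C, f a = ∑ a ∈ C \ A, f a + ∑ a ∈ A, f a := hsplit.symm
    _ ≤ ∑ a ∈ C \ A, f a + 2 * ∑ b ∈ C \ A, f b := Nat.add_le_add_left hAA _
    _ = 3 * ∑ a ∈ C \ A, f a := by ring

/-- **`A ⊕ A ⊕ A = {0,1}^L` for dense subsets `A` of a Hamming-weight class mod 3.**  If
`A ⊆ cls_r = {u : |u| ≡ r (mod 3)}` and `10·#(cls_r ∖ A) ≤ 2^L` with `L ≥ 30`, then every `x` is
`a ⊕ b ⊕ c` with `a, b, c ∈ A`.  (Elementary double count; every density defect `< 1/9` would do for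
`L` large, `1/6` would not.) [folklore] -/
theorem three_xor_cover_of_dense_weightClass (hL : 30 ≤ L) (r : ℕ) (A : Finset (Fin L → Bool))
    (hA : A ⊆ univ.filter fun u : Fin L → Bool => wt u % 3 = r % 3)
    (hB : 10 * ((univ.filter fun u : Fin L → Bool => wt u % 3 = r % 3) \ A).card ≤ 2 ^ L)
    (x : Fin L → Bool) :
    ∃ a ∈ A, ∃ b ∈ A, ∃ c ∈ A, ∀ i, x i = xor (a i) (xor (b i) (c i)) := by
  by_contra hno
  have hcovN := classPairCount_cover r A hA x hno
  set C := univ.filter (fun u : Fin L → Bool => wt u % 3 = r % 3) with hC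
  set f : (Fin L → Bool) → ℕ := fun a => (univ.filter fun b : Fin L → Bool =>
      wt (fun i => xor (xor (x i) (a i)) (b i)) % 3 = r % 3 ∧ wt b % 3 = r % 3).card with hf
  set P : (Fin L → Bool) → ℝ := fun a =>
      (∏ i, if xor (x i) (a i) = true then (2 : ℝ) else 1) +
      (∏ i, if xor (x i) (a i) = true then (1 : ℝ) else 2) with hP
  have hcov : (∑ a ∈ C, (f a : ℝ)) ≤ 3 * ∑ a ∈ C \ A, (f a : ℝ) := by exact_mod_cast hcovN
  have hpt : ∀ a, |9 * (f a : ℝ) - 2 ^ L| ≤ 2 * P a + 4 := by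
    intro a
    have h := abs_nine_mul_classPairCount_sub_two_pow_le r (fun i => xor (x i) (a i))
    beta_reduce at h
    simp only [hf, hP]; linarith [h]
  have hPnn : ∀ a, 0 ≤ P a := by
    intro a
    refine add_nonneg (Finset.prod_nonneg fun i _ => ?_) (Finset.prod_nonneg fun i _ => ?_) <;>
      split_ifs <;> norm_num
  have hPsum : ∑ a : Fin L → Bool, P a = 2 * 3 ^ L := by
    simp only [hP]
    rw [Finset.sum_add_distrib]
    have e1 := sum_comp_xorLeft x (fun y => ∏ i, if y i = true then (2 : ℝ) else 1)
    have e2 := sum_comp_xorLeft x (fun y => ∏ i, if y i = true then (1 : ℝ) else 2)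
    beta_reduce at e1 e2
    rw [e1, e2, sum_prod_ite_eq_add_pow, sum_prod_ite_eq_add_pow]
    ring
  have hCcard : (2 : ℝ) ^ L - 2 ≤ 3 * (C.card : ℝ) := by
    have h3 := abs_three_mul_card_filter_mod_sub_card_le (univ : Finset (Fin L → Bool)) r
    rw [norm_sum_omega3_pow_wt, Finset.card_univ, Fintype.card_fun, Fintype.card_bool,
      Fintype.card_fin, ← hC] at h3
    push_cast at h3
    rw [abs_le] at h3; linarith [h3.1]
  have hCle : (C.card : ℝ) ≤ 2 ^ L := by
    have hle : C.card ≤ 2 ^ L := (Finset.card_le_univ C).trans_eq (by simp)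
    exact_mod_cast hle
  have hlow : (C.card : ℝ) * 2 ^ L - 4 * C.card - 4 * 3 ^ L ≤ 9 * ∑ a ∈ C, (f a : ℝ) := by
    have h1 : ∀ a ∈ C, (2 : ℝ) ^ L - 4 - 2 * P a ≤ 9 * (f a : ℝ) := fun a _ => by
      have := hpt a; rw [abs_le] at this; linarith [this.1]
    have h2 := Finset.sum_le_sum h1
    rw [Finset.sum_sub_distrib, Finset.sum_const, ← Finset.mul_sum, ← Finset.mul_sum,
      nsmul_eq_mul, mul_sub] at h2
    have h3 : ∑ a ∈ C, P a ≤ ∑ a, P a :=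
      Finset.sum_le_sum_of_subset_of_nonneg (Finset.subset_univ C) fun a _ _ => hPnn a
    linarith [hPsum ▸ h3]
  have hupp : 9 * ∑ b ∈ C \ A, (f b : ℝ) ≤
      ((C \ A).card : ℝ) * 2 ^ L + ((C \ A).card : ℝ) * 4 + 4 * 3 ^ L := by
    have h1 : ∀ b ∈ C \ A, 9 * (f b : ℝ) ≤ (2 : ℝ) ^ L + 4 + 2 * P b := fun b _ => by
      have := hpt b; rw [abs_le] at this; linarith [this.2]
    have h2 := Finset.sum_le_sum h1
    rw [← Finset.mul_sum, Finset.sum_add_distrib, Finset.sum_const, ← Finset.mul_sum,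
      nsmul_eq_mul, mul_add] at h2
    have h3 : ∑ b ∈ C \ A, P b ≤ ∑ a, P a :=
      Finset.sum_le_sum_of_subset_of_nonneg (Finset.subset_univ _) fun a _ _ => hPnn a
    linarith [hPsum ▸ h3]
  have hBr : 10 * ((C \ A).card : ℝ) ≤ 2 ^ L := by exact_mod_cast hB
  have h34 : (1000 : ℝ) * 3 ^ L ≤ 2 ^ L * 2 ^ L := by
    have key : ∀ n : ℕ, 30 ≤ n → (1000 : ℝ) * 3 ^ n ≤ 4 ^ n := by
      intro n hn
      induction n, hn using Nat.le_induction with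
      | base => norm_num
      | succ n hn ih =>
        rw [pow_succ, pow_succ]
        nlinarith [ih, pow_nonneg (by norm_num : (0 : ℝ) ≤ 4) n]
    have h4 : (4 : ℝ) ^ L = 2 ^ L * 2 ^ L := by rw [← mul_pow]; norm_num
    rw [← h4]; exact key L hL
  have h23 : (2 : ℝ) ^ L ≤ 3 ^ L := pow_le_pow_left₀ (by norm_num) (by norm_num) L
  have hX : (0 : ℝ) < 2 ^ L := by positivity
  have p1 := mul_le_mul_of_nonneg_right hCcard hX.le
  have p2 := mul_le_mul_of_nonneg_right hBr hX.le
  nlinarith [hlow, hupp, hcov, hCcard, hCle, hBr, h34, h23, hX, p1, p2]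

/-- The same statement with the density hypothesis over `ℝ` (the shape of `Sketch8b.LevelSetD1`). -/
theorem three_xor_cover_of_dense_weightClass_real (hL : 30 ≤ L) (r : ℕ) (A : Finset (Fin L → Bool))
    (hA : A ⊆ univ.filter fun u : Fin L → Bool => wt u % 3 = r % 3)
    (hB : (10 : ℝ) * (((univ.filter fun u : Fin L → Bool => wt u % 3 = r % 3) \ A).card : ℝ) ≤
      (2 : ℝ) ^ L)
    (x : Fin L → Bool) :
    ∃ a ∈ A, ∃ b ∈ A, ∃ c ∈ A, ∀ i, x i = xor (a i) (xor (b i) (c i)) :=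
  three_xor_cover_of_dense_weightClass hL r A hA (by exact_mod_cast hB) x

end Summit.QuantumAdvantage.AdviceFreeQNC0

end
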